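import Summits.QuantumAdvantage.QuantumAdvantage.Theorems.WhiteBoxWalkWbwVerifiableLineNoSpeedupCycleSurgeryDefs

/-!
# Crux `WhiteBoxWalk.WbwVerifiableLineNoSpeedup` (stmt-QuantumAdvantage-2239), line
`cycle-surgery-adversary` — stub `stub_familyNonempty`: both sink parities occur in the family

For `4 ≤ m`, `1 ≤ T`, `T + 1 ≤ 2^(m-1)` the prefix-pinned long-cycle permutation family
`InFamily m T` (definitions module `…CycleSurgeryDefs`) contains a member with even sink and a
member with odd sink. Witnesses: the cyclic shift `x ↦ x + 1` of `Fin (2^m)`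
(`Equiv.addRight 1`; a single `2^m`-cycle through the source, line `x_i = i`, sink `x_T = T`) and
its conjugate by the transposition `swap(T, T+1)` (line `0, 1, …, T-1, T+1`, sink `x_T = T + 1`).
Both have the pinned prefix rows `S x = x + 1` for `x < pre ≤ T - 1`, a simple line, and no
period `j` with `0 < j ≤ hid ≤ T < 2^m` at any point; their sinks `T`, `T + 1` have opposite
parities, so one lies on each side. Elementary; no published fact is used.
-/

noncomputable section

set_option linter.dupNamespace false

namespace Summit.QuantumAdvantage.QuantumAdvantage.Theorems.WbwVerifiableLineNoSpeedup.CycleSurgery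

open Literature.Computability.Cryptography Literature.Computability.QuantumComplexity

/-! ## Both sink parities occur in the family (`stub_familyNonempty`)

Witnesses: the cyclic shift `x ↦ x + 1` of `Fin (2^m)` (a single `2^m`-cycle through the
source, line `x_i = i`, sink `T`) and its conjugate by the transposition `swap(T, T+1)` (line
`0, 1, …, T-1, T+1`, sink `T + 1`). Both have the pinned prefix rows, a simple line, and no period
`≤ hid < 2^m`; their sinks have opposite parities. -/

section FamilyNonempty

variable {m T : ℕ}

/-- Powers of a conjugate by a transposition: `(σ S σ)^j = σ S^j σ` for `σ = swap a b`. -/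
theorem swap_conj_pow {α : Type*} [DecidableEq α] (a b : α) (S : Equiv.Perm α) (j : ℕ) :
    (Equiv.swap a b * S * Equiv.swap a b) ^ j = Equiv.swap a b * S ^ j * Equiv.swap a b := by
  have h := @conj_pow _ _ j (Equiv.swap a b) S
  rwa [Equiv.swap_inv] at h

/-- Values along the powers of the cyclic shift `x ↦ x + 1` of `Fin (2^m)`:
`(x + j) mod 2^m`. -/
theorem val_shift_pow_apply (x : Fin (2 ^ m)) (j : ℕ) :
    ((Equiv.addRight (1 : Fin (2 ^ m)) ^ j) x).val = (x.val + j) % 2 ^ m := by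
  induction j with
  | zero => simp [Nat.mod_eq_of_lt x.isLt]
  | succ j ih =>
    rw [pow_succ', Equiv.Perm.mul_apply]
    change ((Equiv.addRight (1 : Fin (2 ^ m)) ^ j) x + 1).val = _
    rw [Fin.val_add, ih, Fin.val_one', ← Nat.add_mod, Nat.add_assoc]

/-- The cyclic shift has no period `j` with `0 < j < 2^m` at any point. -/
theorem shift_pow_apply_ne (x : Fin (2 ^ m)) {j : ℕ} (hj : 0 < j) (hjm : j < 2 ^ m) :
    (Equiv.addRight (1 : Fin (2 ^ m)) ^ j) x ≠ x := by
  intro h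
  have hv := congrArg Fin.val h
  rw [val_shift_pow_apply] at hv
  rcases Nat.lt_or_ge (x.val + j) (2 ^ m) with hlt | hge
  · rw [Nat.mod_eq_of_lt hlt] at hv
    omega
  · have hx := x.isLt
    rw [Nat.mod_eq_sub_mod hge, Nat.mod_eq_of_lt (by omega)] at hv
    omega

/-- The line of the cyclic shift is `x_i = i` (`i < 2^m`). -/
theorem val_pt_shift {i : ℕ} (hi : i < 2 ^ m) :
    (pt (Equiv.addRight (1 : Fin (2 ^ m))) i).val = i := by
  rw [pt, val_shift_pow_apply]
  simp [src, Nat.mod_eq_of_lt hi]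

/-- `T + 1 ≤ 2^(m-1)` gives `T + 2 ≤ 2^m` (as `1 ≤ m`; here `4 ≤ m`). -/
theorem familyNonempty_two_pow_bound (hm : 4 ≤ m) (hTm : T + 1 ≤ 2 ^ (m - 1)) :
    T + 2 ≤ 2 ^ m := by
  obtain ⟨k, rfl⟩ : ∃ k, m = k + 1 := ⟨m - 1, by omega⟩
  rw [Nat.add_sub_cancel] at hTm
  rw [Nat.pow_succ]
  omega

/-- `pre + 1 ≤ T` as soon as `1 ≤ T` (the hidden window is nonempty). -/
theorem familyNonempty_pre_lt (hT : 1 ≤ T) : pre m T + 1 ≤ T := by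
  have h1 := pre_add_hid m T
  have h2 := one_le_hid (m := m) hT
  omega

/-- **Witness 1.** The cyclic shift `x ↦ x + 1` is a family member, with sink `x_T = T`. -/
theorem shift_inFamily (hm : 4 ≤ m) (hT : 1 ≤ T) (hTm : T + 1 ≤ 2 ^ (m - 1)) :
    InFamily m T (Equiv.addRight (1 : Fin (2 ^ m))) ∧
      sinkOdd m T (Equiv.addRight (1 : Fin (2 ^ m))) = decide (T % 2 = 1) := by
  have h2m : T + 2 ≤ 2 ^ m := familyNonempty_two_pow_bound hm hTm
  have hpre : pre m T + 1 ≤ T := familyNonempty_pre_lt hT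
  have hhid : hid m T ≤ T := hid_le m T
  refine ⟨⟨fun x hx => ?_, fun i j hij => ?_, fun x j hj hjh => ?_⟩, ?_⟩
  · have h := val_shift_pow_apply x 1
    rw [pow_one] at h
    rw [h, Nat.mod_eq_of_lt (by omega)]
  · have hv := congrArg Fin.val hij
    have hi := i.isLt
    have hj := j.isLt
    change (pt _ i.val).val = (pt _ j.val).val at hv
    rw [val_pt_shift (by omega), val_pt_shift (by omega)] at hv
    exact Fin.ext hv
  · exact shift_pow_apply_ne x hj (by omega)
  · unfold sinkOdd
    rw [val_pt_shift (by omega)]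

/-- The line of a conjugate `σ S σ` by a transposition `σ` fixing the source is `σ` of the line
of `S`. -/
theorem pt_swap_conj (a b : Fin (2 ^ m)) (S : Equiv.Perm (Fin (2 ^ m)))
    (h0 : Equiv.swap a b (src m) = src m) (i : ℕ) :
    pt (Equiv.swap a b * S * Equiv.swap a b) i = Equiv.swap a b (pt S i) := by
  change ((Equiv.swap a b * S * Equiv.swap a b) ^ i) (src m) = Equiv.swap a b ((S ^ i) (src m))
  rw [swap_conj_pow, Equiv.Perm.mul_apply, Equiv.Perm.mul_apply, h0]

/-- **Witness 2.** The conjugate of the cyclic shift by `swap(T, T+1)` is a family member, with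
sink `x_T = T + 1`. -/
theorem conjShift_inFamily (hm : 4 ≤ m) (hT : 1 ≤ T) (hTm : T + 1 ≤ 2 ^ (m - 1))
    (a b : Fin (2 ^ m)) (ha : a.val = T) (hb : b.val = T + 1) :
    InFamily m T (Equiv.swap a b * Equiv.addRight (1 : Fin (2 ^ m)) * Equiv.swap a b) ∧
      sinkOdd m T (Equiv.swap a b * Equiv.addRight (1 : Fin (2 ^ m)) * Equiv.swap a b) =
        decide ((T + 1) % 2 = 1) := by
  have h2m : T + 2 ≤ 2 ^ m := familyNonempty_two_pow_bound hm hTm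
  have hpre : pre m T + 1 ≤ T := familyNonempty_pre_lt hT
  have hhid : hid m T ≤ T := hid_le m T
  -- the transposition fixes the source
  have h0 : Equiv.swap a b (src m) = src m := by
    apply Equiv.swap_apply_of_ne_of_ne
    · apply Fin.ne_of_val_ne
      change (0 : ℕ) ≠ a.val
      omega
    · apply Fin.ne_of_val_ne
      change (0 : ℕ) ≠ b.val
      omega
  refine ⟨⟨fun x hx => ?_, fun i j hij => ?_, fun x j hj hjh => ?_⟩, ?_⟩
  · -- prefix rows: `σ x = x`, `x + 1 < T` so `σ (x + 1) = x + 1`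
    have h := val_shift_pow_apply x 1
    rw [pow_one] at h
    have hx1 : (Equiv.addRight (1 : Fin (2 ^ m)) x).val = x.val + 1 := by
      rw [h, Nat.mod_eq_of_lt (by omega)]
    have hσx : Equiv.swap a b x = x :=
      Equiv.swap_apply_of_ne_of_ne (Fin.ne_of_val_ne (by omega)) (Fin.ne_of_val_ne (by omega))
    have hσx1 : Equiv.swap a b (Equiv.addRight (1 : Fin (2 ^ m)) x) =
        Equiv.addRight (1 : Fin (2 ^ m)) x :=
      Equiv.swap_apply_of_ne_of_ne (Fin.ne_of_val_ne (by omega)) (Fin.ne_of_val_ne (by omega))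
    rw [Equiv.Perm.mul_apply, Equiv.Perm.mul_apply, hσx, hσx1, hx1]
  · have hi := i.isLt
    have hj := j.isLt
    have hv : pt (Equiv.addRight (1 : Fin (2 ^ m))) i.val =
        pt (Equiv.addRight (1 : Fin (2 ^ m))) j.val := by
      apply (Equiv.swap a b).injective
      rw [← pt_swap_conj a b _ h0, ← pt_swap_conj a b _ h0]
      exact hij
    have hv' := congrArg Fin.val hv
    rw [val_pt_shift (by omega), val_pt_shift (by omega)] at hv'
    exact Fin.ext hv'
  · rw [swap_conj_pow, Equiv.Perm.mul_apply, Equiv.Perm.mul_apply]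
    intro h
    have h' := congrArg (Equiv.swap a b) h
    rw [Equiv.swap_apply_self] at h'
    exact shift_pow_apply_ne (Equiv.swap a b x) hj (by omega) h'
  · have hptT : pt (Equiv.addRight (1 : Fin (2 ^ m))) T = a :=
      Fin.ext (by rw [val_pt_shift (by omega), ha])
    unfold sinkOdd
    rw [pt_swap_conj a b _ h0, hptT, Equiv.swap_apply_left, hb]

/-- **stub_familyNonempty** — both sink parities occur in the family (`4 ≤ m`, `1 ≤ T`,
`T + 1 ≤ 2^(m-1)`): the `2^m`-cycle `x ↦ x + 1` (sink `T`) and its conjugate by `swap(T, T+1)`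
(sink `T + 1`) are family members with sinks of opposite parities. -/
theorem stub_familyNonempty :
    ∀ m T : ℕ, 4 ≤ m → 1 ≤ T → T + 1 ≤ 2 ^ (m - 1) →
      (∃ S : Equiv.Perm (Fin (2 ^ m)), InFamily m T S ∧ sinkOdd m T S = false) ∧
        ∃ S : Equiv.Perm (Fin (2 ^ m)), InFamily m T S ∧ sinkOdd m T S = true := by
  intro m T hm hT hTm
  have h2m : T + 2 ≤ 2 ^ m := familyNonempty_two_pow_bound hm hTm
  obtain ⟨h1, e1⟩ := shift_inFamily hm hT hTm
  obtain ⟨h2, e2⟩ :=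
    conjShift_inFamily hm hT hTm ⟨T, by omega⟩ ⟨T + 1, by omega⟩ rfl rfl
  rcases Nat.mod_two_eq_zero_or_one T with h0 | h0
  · have hT1 : (T + 1) % 2 = 1 := by omega
    refine ⟨⟨_, h1, ?_⟩, _, h2, ?_⟩
    · rw [e1, h0]
      decide
    · rw [e2, hT1]
      decide
  · have hT1 : (T + 1) % 2 = 0 := by omega
    refine ⟨⟨_, h2, ?_⟩, _, h1, ?_⟩
    · rw [e2, hT1]
      decide
    · rw [e1, h0]
      decide

end FamilyNonempty

end Summit.QuantumAdvantage.QuantumAdvantage.Theorems.WbwVerifiableLineNoSpeedup.CycleSurgery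

end
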